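import Summits.QuantumFields.YangMills.Theorems.UnitScaleTiltProp7PcolOfGradientRow
import Summits.QuantumFields.YangMills.Theorems.UnitScaleTiltProp7KernelRow349Pin
import HarnessLib

/-!
# Route `UnitScaleTilt`, crux K1 «MinimiserStabilityRegPr» (stmt-QuantumFields-19200), EX face S44ᴸγ∕S45∕S46, row `hPcol` — **THE hPcol PIN: P4 ✓`hPcol_of_T1_of_value` AT THE MEMBER WITH
# P3v's COMBES–THOMAS ∕ OPERATOR LETTERS DISCHARGED K-UNIFORMLY at ★p1's pinned coarse weight `c₁ := c₀·(L³)^{K−n}`** — the hPcol twin of namer w2 g12's ✓`Prop7KernelRow349Pin.kernelRow349_pin`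
# (p764315): the EX row `hPcol`'s display at one member CONDITIONAL ONLY on the three K-free sup letters of the LOD propagator — the column VALUE decay `hcol` (V4-class, rate `κ`, constant `C_pt`),
# the general-source VALUE row `hGsup` (`B_v`) and the general-source GRADIENT row `hT1` (`R₁`, T1) — with a constant CLOSED in `(am, κ, C_pt, B_v, R₁)`: no `K`, no `n`, no `|T³|`.

Cell `ym3-torus` (HUMAN RULING D-0037; rung R3 = SU(2) YM₃ on T³ — NOT d = 4, NOT infinite volume, NOT a mass gap, NOT Clay).  Width seat `ym3-torus-px5` (gen 13).
THEOREMS ONLY (0 `def`, 0 `sorry`); `--supports stmt-QuantumFields-19200 --as helper`; count-neutral.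

WHAT.  P4 ✓`Prop7PcolOfGradientRow.hPcol_of_T1_of_value` gives `Σ_x ‖toL2S⁻¹(G′ᴾ_{a′}(R_S(D*_{U₀}(toL2(δ_bd ⊗ E)))))(x)‖ ≤ 4√2·(R₁·(5·(1 + C_src·B_v)))·‖E‖` with P3v's source constant
`C_src = 4·A_T·((m_B²∕2 − 3GAP²)⁻¹e^{9μ′}·4(2(1+1∕μ′))³·c₀(√c₁)⁻¹C_pt ℓ³(2(1+1∕κ))³)` and P3v's window∕gap∕operator letters displayed.  THIS FILE (i) pins `c₁ := c₀·(L³)^{K−n}` so the raw letters are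
numbers (`(25∕8)·c₁ℓ⁻³∕c₀ = 25∕8`, `16c₀ℓ³∕(am·c₁) = 16∕am`), (ii) DISCHARGES `CT CG m_B hcoer` from `RegPr` by ✓`norm_lift_topMean_le` ∕ ✓`norm_massive_inverse_le` ∕ ✓`coarseGram_coercive` ∕
✓`coarseCoercivity_pos` (as the 349 pin), (iii) CHOOSES the Gram slope as a closed term of the LOD mass `am` — `μ(am) := 1∕(10·√(max 2 (16∕am))·√(27 + (2025∕8)am))`,
`μ′(am) := min (μ∕2) (m_B(am)∕(3Γ(am)))`, `δ₁ := √(27 + (2025∕8)am)·μ′` — and PROVES `hδ hwin hgap` for every `η = L^{−(K−n)} ∈ (0,1]` by routeR-w4 g27's ✓`window_delta`∕`window_win`∕`gap_nonneg`∕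
`gap_le`∕`window_gap` (the K-uniformity), (iv) reads off `A_T·c₀(√c₁)⁻¹ℓ³ = 5∕2` EXACTLY (`isolate`, any `c₁`) and the monotone bounds `(m_B²∕2 − 3GAP²)⁻¹ ≤ 6∕m_B²`, `e^{9μ′} ≤ 3`
(✓`exp_nine_mul_le_three`).  OUTPUT ★★★ `hPcol_pin`:
`Σ_x ‖toL2S⁻¹(G′ᴾ_{a′}(R_S(D*_{U₀}(toL2(δ_bd ⊗ E)))))(x)‖ ≤ 4√2·(R₁·(5·(1 + (10·(18∕m_B(am)²)·(4(2(1+1∕μ′(am)))³)·(C_pt·(2(1+1∕κ))³))·B_v)))·‖E‖`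
— displayed: `RegPr` (`10⁷L³ε₀ ≤ 1`), the LOD data `Q″ hseq ι hι T hT G hAG hGA` at the pinned weight and mass `0 < am`, the Lift letters `hRS hker`, `0 ≤ a′` (`G′ᴾ`'s own parameter, the EX face's
`a L i`), and the three sup letters `hcol` (`0 < κ`, `0 ≤ C_pt`), `hGsup`, `hT1` — the (L3′b) VALUE∕GRAD storey's outputs (V4 ✓p762742 via V5b ✓`hcol_of_massiveColumn_decay`; px12 g16's
`…MassiveSolutionGradientSupOfRegPr` §2–§4 over px19 g13's ✓p765411).  The Idx-level ∃-packaging (`ι` by `rfl`, `T := (ι∘Q″)†`, `G` by ✓`exists_massive_inverse` at `am := 1`, `Q″` from the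
face's ∀-form by ✓`hseq_of_htop`, `hRS hker` by ✓`RS_eq_projR_of_lift`, constants per `L` by `choose`) follows px10 g12's ✓`Prop7KernelRow349AllMembers` once the three letters are closed per `L`.
* `AT_mul_Cc_eq` (the `5∕2` identity), `csrc_le_aux`, `rhs_mono` (monotone bookkeeping), ★★★ `hPcol_pin`.
HYP-SAT (★★OWNER RULING №42): as P4 (`hGsup`∕`hT1`∕`hcol` real-inequality schemas, inhabited K-free by the files named; LOD∕Lift letters from ✓`exists_massive_inverse`∕✓`RS_eq_projR_of_lift`);
nothing eventual; the conclusion is a kernel bound for the row's own objects (non-vacuous).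
HONEST SCOPE.  Bookkeeping + real arithmetic over landed rows; CONDITIONAL on `hcol`, `hGsup`, `hT1`; nothing of T1, the general-source VALUE row, `hPcol` at the display index, the nine other print
rows, `hThm2S`, EX or the crux is proved here; the Yang–Mills mass gap is NOT proved.

References: T. Bałaban, CMP **99** (1985) 389–434 [Balaban1985BackgroundPropagators] ((3.11) p.392, (3.21)–(3.25) p.394, Thm 3.1 (3.42)∕(3.46) pp.397–398, (3.49) p.399, Thm 3.11 p.416);
CMP **102** (1985) 277–309 [Balaban1985Variational] ((138)–(139) p.299); CMP **116** (1988) 1–22 [Balaban1988RG2Cluster] ((2.7) p.13).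
-/

set_option autoImplicit false

noncomputable section

open scoped BigOperators Matrix.Norms.L2Operator InnerProductSpace ComplexConjugate Matrix

namespace Summit.QuantumFields.YangMills.Theorems.Prop7PcolPin

open Literature.MathematicalPhysics.QuantumFieldTheory.Balaban1983to89
open Literature.MathematicalPhysics.QuantumFieldTheory.Balaban1983to89.T3ContinuumYM3Torus
open T4Continuum BlockAveraging
open BlockAveraging (Idx)
open B7Prop1Explicit (disp)
open B5Eq118OneStroke (iterBlockOf)
open B10Eq27TorusAxialLog (holT transl)
open B7TransferAnalyticMean (meanCLM)
open B4Sect5Torus (TSite)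
open B9SectCLatticeCarrier (Bond)
open B9Eq311L2Pairing (WL2)
open B11Eq103H1Complex (SiteL2K BondL2K projR)
open Summit.QuantumFields.YangMills.Theorems.Prop8Chart (emlIterU)
open T3SectALandauChart (eta eta_pos bgUnits)
open T3PrintedRegularMinimiser (RegPr)
open T3PrintedRegularOrbits (sites_eq)
open T3LevelShift (siteShift)
open Summit.QuantumFields.YangMills.Theorems.Prop7SectET3Transport (periodsT3 siteEquiv bondEquiv)
open Summit.QuantumFields.YangMills.Theorems.Prop7SectET3HilbertLetters (W₂ toL2 toL2S DL2 DstarL2 covLapSite)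
open Summit.QuantumFields.YangMills.Theorems.Prop7SectET3GaugeProjector (NS RS)
open Summit.QuantumFields.YangMills.Theorems.Prop7SectET3DeltaPiPInv (kerDProj GprimeP)
open Summit.QuantumFields.YangMills.Theorems.Prop7ComplementaryProjectorBlockDecay (norm_lift_topMean_le norm_massive_inverse_le coarseCoercivity_pos)
open Summit.QuantumFields.YangMills.Theorems.Prop7CoarseGramCoercivity (coarseGram_coercive)
open Summit.QuantumFields.YangMills.Theorems.Prop7LODSlotK2WindowLetters
open Summit.QuantumFields.YangMills.Theorems.Prop7KernelRow349Pin (exp_nine_mul_le_three)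
open Summit.QuantumFields.YangMills.Theorems.Prop7PcolOfGradientRow (hPcol_of_T1_of_value)

variable (F : T3Family) {n K : ℕ} (h : n ≤ K) {c₀ cB : ℝ} [Fact (0 < c₀)] [Fact (0 < cB)]
  {ε₀ : ℝ} (hε₀ : 0 < ε₀) (hε7 : 10 ^ 7 * (F.L : ℝ) ^ 3 * ε₀ ≤ 1)
  (U₀ : GaugeField (F.P K) 0 (Matrix.specialUnitaryGroup (Fin 2) ℂ)) (hreg : RegPr F n K ε₀ U₀)
  (Q'' : SiteL2K ℂ 3 (periodsT3 F K) c₀ W₂ →ₗ[ℂ] (Site (F.P K) (K - n) → Matrix (Fin 2) (Fin 2) ℂ))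
  (hseq : ∀ lam : Site (F.P K) 0 → Matrix (Fin 2) (Fin 2) ℂ, ∃ ns : (j : ℕ) → Site (F.P K) j → Matrix (Fin 2) (Fin 2) ℂ, ns 0 = lam ∧
      (∀ (j : ℕ) (y : Site (F.P K) (j + 1)), ns (j + 1) y = ns j (emb y) - meanCLM (Idx (F.P K)) (Matrix (Fin 2) (Fin 2) ℂ) fun i : Idx (F.P K) =>
        ns j (emb y) - ((holT (emlIterU j (bgUnits F K U₀)) (emb y) (stairWord i.2.1 (off i.1)) : (Matrix (Fin 2) (Fin 2) ℂ)ˣ) : Matrix (Fin 2) (Fin 2) ℂ) *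
          ns j (transl (emb y) (disp (stairWord i.2.1 (off i.1)))) * (((holT (emlIterU j (bgUnits F K U₀)) (emb y) (stairWord i.2.1 (off i.1)))⁻¹ : (Matrix (Fin 2) (Fin 2) ℂ)ˣ) : Matrix (Fin 2) (Fin 2) ℂ)) ∧
      ns (K - n) = Q'' (toL2S F K c₀ lam))
  (hRS : RS F n K h c₀ cB U₀ = projR (covLapSite F n K c₀ U₀) Q'')
  (hker : LinearMap.ker Q'' ≤ NS F n K h c₀ cB U₀)

/-! ## §1 Real-arithmetic letters -/

/-- **`A_T·(c₀(√c₁)⁻¹·C·ℓ³·B) = (5∕2)·C·B` EXACTLY** (`A_T = (5∕4)√(2c₁)ℓ⁻³∕c₀·√(2c₁)(√c₁)⁻¹`): P3v's lift size times its column prefactor is K-free for EVERY coarse weight `c₁ > 0`. [folklore] -/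
theorem AT_mul_Cc_eq {c₀' c₁ ℓ3 C B : ℝ} (hc₀ : 0 < c₀') (hc₁ : 0 < c₁) (hℓ : 0 < ℓ3) :
    (5 / 4) * Real.sqrt (2 * c₁) * ℓ3⁻¹ / c₀' * (Real.sqrt (2 * c₁) * (Real.sqrt c₁)⁻¹) * (c₀' * (Real.sqrt c₁)⁻¹ * C * (ℓ3 * B)) = (5 / 2) * C * B := by
  have h2 : Real.sqrt (2 * c₁) * Real.sqrt (2 * c₁) = 2 * c₁ := Real.mul_self_sqrt (by positivity)
  have h1 : Real.sqrt c₁ * Real.sqrt c₁ = c₁ := Real.mul_self_sqrt hc₁.le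
  have hs : 0 < Real.sqrt c₁ := Real.sqrt_pos.2 hc₁
  calc (5 / 4) * Real.sqrt (2 * c₁) * ℓ3⁻¹ / c₀' * (Real.sqrt (2 * c₁) * (Real.sqrt c₁)⁻¹) * (c₀' * (Real.sqrt c₁)⁻¹ * C * (ℓ3 * B))
      = (5 / 4) * (Real.sqrt (2 * c₁) * Real.sqrt (2 * c₁)) * ((Real.sqrt c₁)⁻¹ * (Real.sqrt c₁)⁻¹) * (ℓ3⁻¹ * ℓ3) * (c₀'⁻¹ * c₀') * C * B := by ring
    _ = (5 / 4) * (2 * c₁) * ((Real.sqrt c₁)⁻¹ * (Real.sqrt c₁)⁻¹) * 1 * 1 * C * B := by rw [h2, inv_mul_cancel₀ hℓ.ne', inv_mul_cancel₀ hc₀.ne']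
    _ = (5 / 2) * (c₁ * ((Real.sqrt c₁)⁻¹ * (Real.sqrt c₁)⁻¹)) * C * B := by ring
    _ = (5 / 2) * C * B := by rw [← mul_inv, h1, mul_inv_cancel₀ hc₁.ne']; ring

/-- Monotone bookkeeping for P3v's source constant: `4·A_T·((INV·E9)·F4·Cc) ≤ 4·A_T·((I′·3)·F4·Cc)` for `INV ≤ I′`, `E9 ≤ 3`, all factors `≥ 0`. [folklore] -/
theorem csrc_le_aux {AT INV E9 F4 Cc I' : ℝ} (hAT : 0 ≤ AT) (hI0 : 0 ≤ INV) (hI : INV ≤ I') (hE0 : 0 ≤ E9) (hE : E9 ≤ 3) (hF4 : 0 ≤ F4) (hCc : 0 ≤ Cc) :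
    4 * AT * (INV * E9 * F4 * Cc) ≤ 4 * AT * (I' * 3 * F4 * Cc) := by
  have hI' : 0 ≤ I' := hI0.trans hI
  gcongr

/-- Monotone bookkeeping for P4's constant: `C ≤ C′ ⟹ 4√2·(R₁·(5·(1 + C·B_v)))·e ≤ 4√2·(R₁·(5·(1 + C′·B_v)))·e` (`R₁, B_v, e ≥ 0`). [folklore] -/
theorem rhs_mono {R₁ Bv C C' e : ℝ} (hR : 0 ≤ R₁) (hB : 0 ≤ Bv) (hC : C ≤ C') (he : 0 ≤ e) :
    4 * Real.sqrt 2 * (R₁ * (5 * (1 + C * Bv))) * e ≤ 4 * Real.sqrt 2 * (R₁ * (5 * (1 + C' * Bv))) * e := by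
  gcongr

/-! ## §2 ★★★ The hPcol pin -/

include hε₀ hε7 hreg hseq hRS hker in
-- HEARTBEAT rule (README): measured — passes at the DEFAULT budget and at a decl-local `maxHeartbeats 100000` probe (29.7 s farm wall); no budget line.
/-- ★★★ **THE hPcol PIN.**  For `n < K`, `U₀ ∈ 𝔘_k(ε₀)` (`10⁷L³ε₀ ≤ 1`), a top nested mean `Q″` (clause (iv) `hseq`) with the Lift letters `hRS : R_S = projR Δ^η Q″`, `hker : ker Q″ ≤ N_S`, the LOD
massive data at ★p1's pinned coarse weight `c₁ := c₀·(L³)^{K−n}` (`ι hι T hT`, mass `0 < am`, inverse `G hAG hGA`), `G′ᴾ`'s parameter `0 ≤ a′`, a column VALUE letter `hcol` (rate `0 < κ`, constant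
`0 ≤ C_pt`) and the two general-source sup→sup letters `hGsup` (`B_v`), `hT1` (`R₁`): for every bond `bd` and matrix `E`,
`Σ_x ‖toL2S⁻¹(G′ᴾ_{a′}(R_S(D*_{U₀}(toL2(δ_bd ⊗ E)))))(x)‖ ≤ 4√2·(R₁·(5·(1 + (10·(18∕m_B(am)²)·(4(2(1+1∕μ′(am)))³)·(C_pt·(2(1+1∕κ))³))·B_v)))·‖E‖`,
`m_B(am) = 2∕((1 + 25∕8)(600(27∕4)⁶ + am))`, `μ′(am) = min (μ(am)∕2) (m_B(am)∕(3Γ(am)))` (closed, see the module docstring) — no `K`, `n`, `|T³|` in the constant.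
[cite: Balaban1985Variational, (138)–(139) p.299; Balaban1985BackgroundPropagators, Thm 3.1 (3.42)∕(3.46) pp.397–398, (3.49) p.399, Thm 3.11 p.416; Balaban1988RG2Cluster, (2.7) p.13] -/
theorem hPcol_pin (hnK : n < K) {am : ℝ} (ham : 0 < am) [hc₁ : Fact (0 < c₀ * ((F.L : ℝ) ^ 3) ^ (K - n))]
    (ι : (Site (F.P K) (K - n) → Matrix (Fin 2) (Fin 2) ℂ) →ₗ[ℂ] SiteL2K ℂ 3 (periodsT3 F n) (c₀ * ((F.L : ℝ) ^ 3) ^ (K - n)) W₂)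
    (hι : ∀ c, ι c = toL2S F n (c₀ * ((F.L : ℝ) ^ 3) ^ (K - n)) (fun z => c (siteShift (sites_eq F n K h) z)))
    (T : SiteL2K ℂ 3 (periodsT3 F n) (c₀ * ((F.L : ℝ) ^ 3) ^ (K - n)) W₂ →ₗ[ℂ] SiteL2K ℂ 3 (periodsT3 F K) c₀ W₂)
    (hT : ∀ (l : SiteL2K ℂ 3 (periodsT3 F K) c₀ W₂) (f : SiteL2K ℂ 3 (periodsT3 F n) (c₀ * ((F.L : ℝ) ^ 3) ^ (K - n)) W₂), ⟪ι (Q'' l), f⟫_ℂ = ⟪l, T f⟫_ℂ)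
    (G : SiteL2K ℂ 3 (periodsT3 F K) c₀ W₂ →ₗ[ℂ] SiteL2K ℂ 3 (periodsT3 F K) c₀ W₂)
    (hAG : ∀ f, covLapSite F n K c₀ U₀ (G f) + (am : ℂ) • T (ι (Q'' (G f))) = f)
    (hGA : ∀ u, G (covLapSite F n K c₀ U₀ u + (am : ℂ) • T (ι (Q'' u))) = u)
    {a' : ℝ} (ha' : 0 ≤ a')
    {κ Cpt : ℝ} (hκ : 0 < κ) (hCpt : 0 ≤ Cpt)
    (hcol : ∀ (y : Site (F.P K) (K - n)) (Y : Matrix (Fin 2) (Fin 2) ℂ) (x : Site (F.P K) 0),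
      ‖WL2.equiv ℂ _ W₂ (G (T (ι (Pi.single y Y)))) (siteEquiv F K x)‖ ≤ Cpt * Real.exp (-(κ * (Site.tdist (P := F.P K) (iterBlockOf (K - n) x) y : ℝ))) * ‖Y‖)
    {Bv : ℝ} (hGsup : ∀ (f : SiteL2K ℂ 3 (periodsT3 F K) c₀ W₂) (Fb : ℝ), (∀ y, ‖WL2.equiv ℂ _ W₂ f y‖ ≤ Fb) → ∀ y, ‖WL2.equiv ℂ _ W₂ (G f) y‖ ≤ Bv * Fb)
    {R₁ : ℝ} (hT1 : ∀ (f : SiteL2K ℂ 3 (periodsT3 F K) c₀ W₂) (Fb : ℝ), (∀ y, ‖WL2.equiv ℂ _ W₂ f y‖ ≤ Fb) →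
      ∀ p : Bond 3 (periodsT3 F K), ‖WL2.equiv ℂ _ W₂ (DL2 F n K c₀ U₀ (G f)) p‖ ≤ R₁ * Fb)
    (bd : PBond (F.P K) 0) (E : Matrix (Fin 2) (Fin 2) ℂ) :
    ∑ x : Site (F.P K) 0, ‖(toL2S F K c₀).symm (GprimeP F n K h c₀ cB a' U₀ (RS F n K h c₀ cB U₀ (DstarL2 F n K c₀ U₀ (toL2 F K c₀ (Pi.single bd E))))) x‖
      ≤ 4 * Real.sqrt 2 * (R₁ * (5 * (1 + (10 * (18 / (2 / ((1 + 25 / 8) * (600 * (27 / 4 : ℝ) ^ 6 + am))) ^ 2) * (4 * (2 * (1 + 1 / (min ((1 / (10 * Real.sqrt (max 2 (16 / am)) * Real.sqrt (27 + 2025 / 8 * am))) / 2) ((2 / ((1 + 25 / 8) * (600 * (27 / 4 : ℝ) ^ 6 + am))) / (3 * (Real.sqrt (max 2 (16 / am)) * (2 + Real.sqrt (max 2 (16 / am))) * (3 * Real.sqrt 3 + 27 + 9 * Real.sqrt am * Real.sqrt (25 / 8) + 81 * am * (25 / 8))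
                * (8 * Real.sqrt (max 2 (16 / am)) + 8 * Real.sqrt (max 2 (16 / am)) ^ 2) * (10 * Real.sqrt (25 / 8)) + 9 * (max 2 (16 / am)) * Real.sqrt (25 / 8))))))) ^ 3) * (Cpt * (2 * (1 + 1 / κ)) ^ 3)) * Bv))) * ‖E‖ := by
  have hc₀ : 0 < c₀ := Fact.out
  have hc₁ : 0 < c₀ * ((F.L : ℝ) ^ 3) ^ (K - n) := hc₁.out
  have hL1 : (1 : ℝ) < F.L := by exact_mod_cast F.hL.2
  have hL0 : (0 : ℝ) < F.L := by linarith
  have hLP := (F.P K).L_pos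
  -- ★p1's pin `c₁ := c₀(L³)^(K−n)`: the raw letters are K-free numbers
  have hsx : (25 / 8) * (c₀ * ((F.L : ℝ) ^ 3) ^ (K - n) * ((((F.P K).L : ℝ) ^ (F.P K).d) ^ (K - n))⁻¹ / c₀) = 25 / 8 := by
    rw [show ((F.P K).L : ℝ) = (F.L : ℝ) from rfl, T3Family.P_d]; field_simp
  have hMraw : 16 * c₀ * ((F.L : ℝ) ^ (K - n)) ^ 3 / (am * (c₀ * ((F.L : ℝ) ^ 3) ^ (K - n))) = 16 / am := by
    rw [← pow_mul, ← pow_mul, Nat.mul_comm]; field_simp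
  have hM : max 2 (16 * c₀ * ((F.L : ℝ) ^ (K - n)) ^ 3 / (am * (c₀ * ((F.L : ℝ) ^ 3) ^ (K - n)))) = max 2 (16 / am) := by rw [hMraw]
  have hdEx : 600 * (27 / 4 : ℝ) ^ 6 * (c₀ * ((F.L : ℝ) ^ 3) ^ (K - n) / (c₀ * ((F.L : ℝ) ^ 3) ^ (K - n))) = 600 * (27 / 4 : ℝ) ^ 6 := by
    rw [div_self (by positivity), mul_one]
  have hη : 0 < eta F n K := eta_pos F n K
  have hη1 : eta F n K ≤ 1 := by
    show ((F.L : ℝ)⁻¹) ^ (K - n) ≤ 1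
    exact pow_le_one₀ (inv_nonneg.2 hL0.le) (inv_le_one_of_one_le₀ hL1.le)
  -- the closed letters of the massive mass `am`
  set M' : ℝ := max 2 (16 / am) with hM'def
  have hM'2 : 2 ≤ M' := le_max_left _ _
  set cδ : ℝ := 27 + 2025 / 8 * am with hcδdef
  have hcδ1 : 1 ≤ cδ := by rw [hcδdef]; linarith [ham.le]
  set μ : ℝ := 1 / (10 * Real.sqrt M' * Real.sqrt cδ) with hμdef
  have hsM1 : 1 ≤ Real.sqrt M' := Real.one_le_sqrt.2 (by linarith)
  have hsc1 : 1 ≤ Real.sqrt cδ := Real.one_le_sqrt.2 hcδ1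
  have hμ0 : 0 < μ := by rw [hμdef]; positivity
  have hμ10 : 10 * μ ≤ 1 := by
    rw [hμdef]
    have h1 : (1 : ℝ) ≤ Real.sqrt M' * Real.sqrt cδ := one_le_mul_of_one_le_of_one_le hsM1 hsc1
    rw [show 10 * (1 / (10 * Real.sqrt M' * Real.sqrt cδ)) = 1 / (Real.sqrt M' * Real.sqrt cδ) by field_simp]
    rw [div_le_one (by positivity)]
    exact h1
  set Γ : ℝ := (Real.sqrt (max 2 (16 / am)) * (2 + Real.sqrt (max 2 (16 / am))) * (3 * Real.sqrt 3 + 27 + 9 * Real.sqrt am * Real.sqrt (25 / 8) + 81 * am * (25 / 8))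
                * (8 * Real.sqrt (max 2 (16 / am)) + 8 * Real.sqrt (max 2 (16 / am)) ^ 2) * (10 * Real.sqrt (25 / 8)) + 9 * (max 2 (16 / am)) * Real.sqrt (25 / 8)) with hΓdef
  have hΓ : 0 < Γ := by rw [hΓdef]; positivity
  set mBc : ℝ := (2 / ((1 + 25 / 8) * (600 * (27 / 4 : ℝ) ^ 6 + am))) with hmBcdef
  have hmBc : 0 < mBc := by rw [hmBcdef]; positivity
  set μ' : ℝ := min (μ / 2) (mBc / (3 * Γ)) with hμ'def
  have hμ'0 : 0 < μ' := lt_min (by linarith) (by positivity)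
  have hμ'le : μ' ≤ μ / 2 := min_le_left _ _
  have hμ'lt : μ' < μ := by linarith
  have hμ'3 : 3 * μ' ≤ 1 := by linarith
  have hμ'9 : 9 * μ' ≤ 1 := by linarith
  have hμ'Γ' : μ' ≤ mBc / (3 * Γ) := min_le_right _ _
  -- the window rows at the raw letters (routeR-w4 g27's W1), at slope `μ′`
  have hδ := window_delta (a := am) (sx := ((25 / 8) * (c₀ * ((F.L : ℝ) ^ 3) ^ (K - n) * ((((F.P K).L : ℝ) ^ (F.P K).d) ^ (K - n))⁻¹ / c₀))) (η := eta F n K) ham hsx hη hη1 hμ'0.le hμ'3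
  have hwinμ := window_win ham hM
  have hwin : Real.sqrt (max 2 (16 * c₀ * ((F.L : ℝ) ^ (K - n)) ^ 3 / (am * (c₀ * ((F.L : ℝ) ^ 3) ^ (K - n))))) * (Real.sqrt cδ * μ') ≤ 1 / 10 := by
    refine le_trans ?_ hwinμ
    apply mul_le_mul_of_nonneg_left _ (Real.sqrt_nonneg _)
    exact mul_le_mul_of_nonneg_left hμ'lt.le (Real.sqrt_nonneg _)
  have hG0 := gap_nonneg (a := am) (sx := ((25 / 8) * (c₀ * ((F.L : ℝ) ^ 3) ^ (K - n) * ((((F.P K).L : ℝ) ^ (F.P K).d) ^ (K - n))⁻¹ / c₀))) (η := eta F n K)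
    (M := max 2 (16 * c₀ * ((F.L : ℝ) ^ (K - n)) ^ 3 / (am * (c₀ * ((F.L : ℝ) ^ 3) ^ (K - n))))) (μ' := μ') ham hη (by positivity) hμ'0.le
  have hGle := gap_le (a := am) (sx := ((25 / 8) * (c₀ * ((F.L : ℝ) ^ 3) ^ (K - n) * ((((F.P K).L : ℝ) ^ (F.P K).d) ^ (K - n))⁻¹ / c₀))) (η := eta F n K)
    (M := max 2 (16 * c₀ * ((F.L : ℝ) ^ (K - n)) ^ 3 / (am * (c₀ * ((F.L : ℝ) ^ 3) ^ (K - n))))) (μ' := μ') ham hsx hη hη1 hM hμ'0.le hμ'3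
  have hmBraw : (2 / ((1 + ((25 / 8) * (c₀ * ((F.L : ℝ) ^ 3) ^ (K - n) * ((((F.P K).L : ℝ) ^ (F.P K).d) ^ (K - n))⁻¹ / c₀))) * ((600 * (27 / 4 : ℝ) ^ 6 * (c₀ * ((F.L : ℝ) ^ 3) ^ (K - n) / (c₀ * ((F.L : ℝ) ^ 3) ^ (K - n)))) + am))) = mBc := by
    rw [hsx, hdEx]
  have hμ'Γ : μ' ≤ (2 / ((1 + ((25 / 8) * (c₀ * ((F.L : ℝ) ^ 3) ^ (K - n) * ((((F.P K).L : ℝ) ^ (F.P K).d) ^ (K - n))⁻¹ / c₀))) * ((600 * (27 / 4 : ℝ) ^ 6 * (c₀ * ((F.L : ℝ) ^ 3) ^ (K - n) / (c₀ * ((F.L : ℝ) ^ 3) ^ (K - n)))) + am))) / (3 * Γ) := by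
    rw [hmBraw]; exact hμ'Γ'
  obtain ⟨hgap, hP2pos, hP2⟩ := window_gap hG0 hGle hΓ (by rw [hmBraw]; exact hmBc) hμ'Γ
  -- the three operator letters at `RegPr` (routeR-w2's B6 dischargers)
  have hCTb := norm_lift_topMean_le F h hε₀ hε7 U₀ hreg Q'' hseq ι hι
  have hGn := norm_massive_inverse_le F h hε₀ hε7 U₀ hreg Q'' hseq ι hι T hT ham G hAG
  have hcoer := coarseGram_coercive F hnK h hε₀ hε7 U₀ hreg Q'' hseq ι hι T hT ham G hAG
  have hmB := coarseCoercivity_pos F (n := n) (K := K) (c₀ := c₀) (c₁ := c₀ * ((F.L : ℝ) ^ 3) ^ (K - n)) ham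
  -- nonnegativity of the two abstract constants (test the letters at `f = 0`, `F_b = 1`)
  have h0 : ∀ y, ‖WL2.equiv ℂ _ W₂ (0 : SiteL2K ℂ 3 (periodsT3 F K) c₀ W₂) y‖ ≤ 1 := fun y => by
    rw [WL2.equiv_zero, Pi.zero_apply, norm_zero]; exact zero_le_one
  have hBv : 0 ≤ Bv := by
    have := hGsup 0 1 h0 (siteEquiv F K bd.src)
    rwa [map_zero, WL2.equiv_zero, Pi.zero_apply, norm_zero, mul_one] at this
  have hR₁ : 0 ≤ R₁ := by
    have := hT1 0 1 h0 (bondEquiv F K bd)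
    rwa [map_zero, map_zero, WL2.equiv_zero, Pi.zero_apply, norm_zero, mul_one] at this
  -- P4 at these letters
  have hP4 := hPcol_of_T1_of_value F h hε₀ hε7 U₀ hreg Q'' hseq ι hι T hT ham G hAG hGA hRS hker ha' hμ'0 (δ₁ := Real.sqrt cδ * μ') (by positivity) hδ hwin
    (Real.sqrt_nonneg _) hCTb (by positivity) hGn hmB hcoer hgap hCpt hκ hcol hGsup hT1 bd E
  -- monotone bookkeeping of the source constant
  have hexp9 : Real.exp (9 * μ') ≤ 3 := exp_nine_mul_le_three hμ'9
  have hI0 := (inv_pos.2 hP2pos).le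
  have hAT : 0 ≤ (5 / 4) * Real.sqrt (2 * (c₀ * ((F.L : ℝ) ^ 3) ^ (K - n))) * ((((F.P K).L : ℝ) ^ (F.P K).d) ^ (K - n))⁻¹ / c₀ * (Real.sqrt (2 * (c₀ * ((F.L : ℝ) ^ 3) ^ (K - n))) * (Real.sqrt (c₀ * ((F.L : ℝ) ^ 3) ^ (K - n)))⁻¹) := by positivity
  have hF4 : 0 ≤ 4 * (2 * (1 + 1 / μ')) ^ 3 := by positivity
  have hCc : 0 ≤ c₀ * (Real.sqrt (c₀ * ((F.L : ℝ) ^ 3) ^ (K - n)))⁻¹ * Cpt * (((((F.P K).L : ℝ) ^ (F.P K).d) ^ (K - n)) * (2 * (1 + 1 / κ)) ^ 3) := by positivity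
  have hcs := csrc_le_aux hAT hI0 hP2 (Real.exp_pos _).le hexp9 hF4 hCc
  have hid := AT_mul_Cc_eq (C := Cpt) (B := (2 * (1 + 1 / κ)) ^ 3) hc₀ hc₁ (by positivity : (0:ℝ) < (((F.P K).L : ℝ) ^ (F.P K).d) ^ (K - n))
  refine hP4.trans (rhs_mono hR₁ hBv (hcs.trans (le_of_eq ?_)) (norm_nonneg _))
  rw [hmBraw]
  calc 4 * ((5 / 4) * Real.sqrt (2 * (c₀ * ((F.L : ℝ) ^ 3) ^ (K - n))) * ((((F.P K).L : ℝ) ^ (F.P K).d) ^ (K - n))⁻¹ / c₀ * (Real.sqrt (2 * (c₀ * ((F.L : ℝ) ^ 3) ^ (K - n))) * (Real.sqrt (c₀ * ((F.L : ℝ) ^ 3) ^ (K - n)))⁻¹))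
        * (6 / mBc ^ 2 * 3 * (4 * (2 * (1 + 1 / μ')) ^ 3) * (c₀ * (Real.sqrt (c₀ * ((F.L : ℝ) ^ 3) ^ (K - n)))⁻¹ * Cpt * (((((F.P K).L : ℝ) ^ (F.P K).d) ^ (K - n)) * (2 * (1 + 1 / κ)) ^ 3)))
      = 4 * (6 / mBc ^ 2 * 3 * (4 * (2 * (1 + 1 / μ')) ^ 3)) * ((5 / 4) * Real.sqrt (2 * (c₀ * ((F.L : ℝ) ^ 3) ^ (K - n))) * ((((F.P K).L : ℝ) ^ (F.P K).d) ^ (K - n))⁻¹ / c₀ * (Real.sqrt (2 * (c₀ * ((F.L : ℝ) ^ 3) ^ (K - n))) * (Real.sqrt (c₀ * ((F.L : ℝ) ^ 3) ^ (K - n)))⁻¹)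
          * (c₀ * (Real.sqrt (c₀ * ((F.L : ℝ) ^ 3) ^ (K - n)))⁻¹ * Cpt * (((((F.P K).L : ℝ) ^ (F.P K).d) ^ (K - n)) * (2 * (1 + 1 / κ)) ^ 3))) := by ring
    _ = 4 * (6 / mBc ^ 2 * 3 * (4 * (2 * (1 + 1 / μ')) ^ 3)) * ((5 / 2) * Cpt * (2 * (1 + 1 / κ)) ^ 3) := by rw [hid]
    _ = (10 * (18 / (2 / ((1 + 25 / 8) * (600 * (27 / 4 : ℝ) ^ 6 + am))) ^ 2) * (4 * (2 * (1 + 1 / (min ((1 / (10 * Real.sqrt (max 2 (16 / am)) * Real.sqrt (27 + 2025 / 8 * am))) / 2) ((2 / ((1 + 25 / 8) * (600 * (27 / 4 : ℝ) ^ 6 + am))) / (3 * (Real.sqrt (max 2 (16 / am)) * (2 + Real.sqrt (max 2 (16 / am))) * (3 * Real.sqrt 3 + 27 + 9 * Real.sqrt am * Real.sqrt (25 / 8) + 81 * am * (25 / 8))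
                * (8 * Real.sqrt (max 2 (16 / am)) + 8 * Real.sqrt (max 2 (16 / am)) ^ 2) * (10 * Real.sqrt (25 / 8)) + 9 * (max 2 (16 / am)) * Real.sqrt (25 / 8))))))) ^ 3) * (Cpt * (2 * (1 + 1 / κ)) ^ 3)) := by rw [hmBcdef, hμ'def, hμdef, hM'def, hcδdef, hΓdef]; ring

end Summit.QuantumFields.YangMills.Theorems.Prop7PcolPin

end
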